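import Mathlib.Topology.Algebra.OpenSubgroup
import Literature.AnabelianGeometry.SemiGraphs.SubgroupPresentationArithLevels

/-!
# The arithmetic level kernels: elements congruent to the identity modulo a level act trivially
# ([SemiAnbd] Def 5.1 (i)(c) continuity, Prop 5.2 (i)/(iv) p. 64)

Mochizuki, *Semi-graphs of anabelioids*, Publ. RIMS **42** (2006) 221–322, Def 5.1 (i) p. 62 ((c): "the
action of `H` on `𝔾` is trivial; the resulting outer homomorphism `H → Out(π̂₁(𝒢_v))` … is
continuous"), Prop 5.2 (i) p. 63 ("every tempered covering of `𝒢` appears as the geometric component of a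
tempered covering of `𝔊`"), (iv) p. 64 [cite: MochizukiSemiAnbd2006, Prop 5.2 (iv), p. 64].

PROOF-ONLY (no definitions, no named facts; row T54-B-top of the producer debt T54-B,
`HOME/plan/GAP-LEDGER.md` G-w4d053-1; seat abc-iut-L3-d2).  In abc-iut-L3-d4's coset-graph model of
the arithmetic tower (`SubgroupPresentationCosetGraph/ArithCompat/ArithAction/ArithLevels`), the
tempered topology on the arithmetic group `E` is glued from the LEVEL KERNELS
`levelKer L = ker (arithAct L) ⊓ ker σ ⊓ centralMod Φ L` (`TemperedExtensionTempered`,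
`ArithTemperedGroupTopology`), and the one input that is not group theory is the binder
`hK1′ : IsOpen (aug (levelKer L))` ("continuity of the arithmetic action").  This file REDUCES that
binder to a statement about the outer action alone:

* `arithAct_eq_one_of_conj_mem_level` — if `σ e = 1`, `Φ_e ≡ id (mod L)` and the vertex and edge
  conjugators of `e` can be taken IN `L`, then `e` acts trivially on the level-`L` coset semi-graph;
  hence (`mem_levelKer_of_conj_mem_level`) `e ∈ levelKer L`;
* `isOpen_map_levelKer_of_congruent_lifts` — consequently `aug (levelKer L)` is open as soon as every
  `a` in some neighbourhood of `1` of `Π_A` lifts to such an `e` ("`ρ` is congruence-continuous at the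
  level `L`": the group-theoretic content of Def 5.1 (i)(c) that Prop 5.2 (i) uses);
* `isOpen_map_of_antitone` — for an antitone family of kernels openness of the images at DEEP levels
  gives it at all levels (so the producer only owes `hK1′` eventually).

Nothing here refers to the IUT corpus; no side is taken on [IUTchIII] Cor 3.12; typed ≠ proved.
-/

namespace Literature.AnabelianGeometry.SemiGraphs

open CategoryTheory Topology

universe u v w

namespace SemiGraph

namespace SubgroupPresentation

variable {𝔾 : SemiGraph.{u}} {Γ : Type u} [Group Γ] {E : Type v} [Group E]
  (P : SubgroupPresentation 𝔾 Γ) {Φ : E →* MulAut Γ} {σ : E →* Aut 𝔾}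
  (hP : P.IsArithCompatible Φ σ) (L : Subgroup Γ) (hL : ∀ (e : E) (x : Γ), x ∈ L → Φ e x ∈ L)

/-- Double cosets modulo a normal level absorb a left factor from the level and a congruence:
if `k ∈ L`, `Φ y · y⁻¹ ∈ L` and `L` is normal then `H (k⁻¹ Φ y) L = H y L`. [folklore] -/
private theorem mk_inv_mul_eq_of_mem (H : Subgroup Γ) [L.Normal] {k z y : Γ} (hk : k ∈ L)
    (hz : z * y⁻¹ ∈ L) : DoubleCoset.mk H L (k⁻¹ * z) = DoubleCoset.mk H L y := by
  rw [DoubleCoset.eq]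
  refine ⟨1, H.one_mem, (k⁻¹ * z)⁻¹ * y, ?_, by group⟩
  -- `(k⁻¹ z)⁻¹ y = (z⁻¹ y) · (y⁻¹ k y)` lies in the normal subgroup `L`
  have h1 : z⁻¹ * y ∈ L := by
    have : y⁻¹ * (z * y⁻¹)⁻¹ * y ∈ L := Subgroup.Normal.conj_mem' inferInstance _ (inv_mem hz) y
    simpa [mul_assoc] using this
  have h2 : y⁻¹ * k * y ∈ L := Subgroup.Normal.conj_mem' inferInstance _ hk y
  have : (k⁻¹ * z)⁻¹ * y = (z⁻¹ * y) * (y⁻¹ * k * y) := by group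
  rw [this]
  exact mul_mem h1 h2

/-- **An element of `E` fixing `𝔾`, congruent to the identity modulo the level `L`, and with vertex
and edge conjugators in `L`, acts trivially on the level-`L` coset semi-graph** (the mechanism behind
Prop 5.2 (i): a small element of `Π_A` lifts to an automorphism of the level acting trivially on its
underlying semi-graph). [cite: MochizukiSemiAnbd2006, Prop 5.2 (i), p. 63] -/
theorem arithAct_eq_one_of_conj_mem_level [L.Normal] {e : E} (hσ : σ e = 1)
    (hV : ∀ w : 𝔾.Vertex, ∃ k ∈ L, P.IsVConj Φ σ e w k)
    (hE : ∀ ε : 𝔾.Edge, ∃ m ∈ L, P.IsEConj Φ σ e ε m)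
    (hcong : ∀ y : Γ, Φ e y * y⁻¹ ∈ L) : P.arithAct hP L hL e = 1 := by
  ext : 1
  refine P.hom_ext_mk L _ _ (fun w y => ?_) (fun ε y => ?_) (fun b y => ?_)
  · obtain ⟨k, hk, hkV⟩ := hV w
    change (P.arithHom hP L hL e).vertexMap _ = P.vMk L w y
    rw [P.arithHom_vertexMap_vMk hP L hL hkV]
    exact P.vMk_eq L (by rw [hσ]; rfl) (mk_inv_mul_eq_of_mem L (P.H w) hk (hcong y))
  · obtain ⟨m, hm, hmE⟩ := hE ε
    change (P.arithHom hP L hL e).edgeMap _ = P.eMk L ε y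
    rw [P.arithHom_edgeMap_eMk hP L hL hmE]
    exact P.eMk_eq L (by rw [hσ]; rfl) (mk_inv_mul_eq_of_mem L (P.M ε) hm (hcong y))
  · obtain ⟨m, hm, hmE⟩ := hE (𝔾.edgeOf b)
    change (P.arithHom hP L hL e).branchMap _ = P.bMk L b y
    rw [P.arithHom_branchMap_bMk hP L hL hmE]
    exact P.branch_eq L (by rw [hσ]; rfl) (by rw [hσ]; rfl)
      (mk_inv_mul_eq_of_mem L (P.M (𝔾.edgeOf b)) hm (hcong y)) _ _

/-- Such an element lies in the level kernel `levelKer L = ker (arithAct L) ⊓ ker σ ⊓ centralMod Φ L`.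
[cite: MochizukiSemiAnbd2006, Prop 5.2 (iv), p. 64] -/
theorem mem_levelKer_of_conj_mem_level [L.Normal] {e : E} (hσ : σ e = 1)
    (hV : ∀ w : 𝔾.Vertex, ∃ k ∈ L, P.IsVConj Φ σ e w k)
    (hE : ∀ ε : 𝔾.Edge, ∃ m ∈ L, P.IsEConj Φ σ e ε m)
    (hcong : ∀ y : Γ, Φ e y * y⁻¹ ∈ L) : e ∈ P.levelKer hP L hL := by
  rw [P.mem_levelKer_iff hP L hL]
  exact ⟨P.arithAct_eq_one_of_conj_mem_level hP L hL hσ hV hE hcong, hσ, hcong⟩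

/-- **Reduction of the continuity binder `hK1′`**: if every element of some neighbourhood of `1` of
`Π_A` lifts along `aug` to an element of `E` fixing `𝔾`, congruent to the identity modulo `L` and
with conjugators in `L` ("the outer action is congruence-continuous at the level `L`", Def 5.1 (i)(c)
as used by Prop 5.2 (i)), then the image `aug (levelKer L)` is an OPEN subgroup of `Π_A`.
[cite: MochizukiSemiAnbd2006, Prop 5.2 (i), p. 63] -/
theorem isOpen_map_levelKer_of_congruent_lifts [L.Normal] {A : Type w} [Group A]
    [TopologicalSpace A] [ContinuousMul A] (aug : E →* A) {U : Set A} (hU : U ∈ 𝓝 (1 : A))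
    (hlift : ∀ a ∈ U, ∃ e : E, aug e = a ∧ σ e = 1 ∧
      (∀ w : 𝔾.Vertex, ∃ k ∈ L, P.IsVConj Φ σ e w k) ∧
      (∀ ε : 𝔾.Edge, ∃ m ∈ L, P.IsEConj Φ σ e ε m) ∧ ∀ y : Γ, Φ e y * y⁻¹ ∈ L) :
    IsOpen (((P.levelKer hP L hL).map aug : Subgroup A) : Set A) := by
  apply Subgroup.isOpen_of_mem_nhds _ (g := 1)
  apply Filter.mem_of_superset hU
  intro a ha
  obtain ⟨e, rfl, hσ, hV, hE, hcong⟩ := hlift a ha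
  exact ⟨e, P.mem_levelKer_of_conj_mem_level hP L hL hσ hV hE hcong, rfl⟩

/-! ### On SIMPLE levels with self-normalising vertex images the conjugator clauses are automatic -/

/-- Congruence modulo `L` passes to the quotient: `π (Φ_e x) = π x`. [folklore] -/
private theorem mk_map_eq_of_congruent [L.Normal] {e : E} (hcong : ∀ y : Γ, Φ e y * y⁻¹ ∈ L) (x : Γ) :
    (QuotientGroup.mk' L) (Φ e x) = (QuotientGroup.mk' L) x := by
  rw [QuotientGroup.mk'_apply, QuotientGroup.mk'_apply, QuotientGroup.eq]
  have h : x⁻¹ * (Φ e x * x⁻¹) * x ∈ L := Subgroup.Normal.conj_mem' inferInstance _ (hcong x) x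
  have : (Φ e x)⁻¹ * x = (x⁻¹ * (Φ e x * x⁻¹) * x)⁻¹ := by group
  rw [this]
  exact L.inv_mem h

include hP in
/-- **Vertex conjugators can be taken in the level** when `Φ_e ≡ id (mod L)`, `σ_e = 1` and the image of
every `H_w` in `Γ ⧸ L` is self-normalising (true at the TREE levels of the arithmetic tower: distinct
vertices of the universal graph-covering have distinct stabilisers, [SemiAnbd] Thm 3.7 (ii)).
[cite: MochizukiSemiAnbd2006, Prop 5.2 (i), p. 63] -/
theorem exists_isVConj_mem_of_congruent [L.Normal] {e : E} (hσ : σ e = 1)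
    (hcong : ∀ y : Γ, Φ e y * y⁻¹ ∈ L)
    (hself : ∀ (w : 𝔾.Vertex) (q : Γ ⧸ L),
      (∀ x : Γ ⧸ L, x ∈ (P.H w).map (QuotientGroup.mk' L) ↔
        q⁻¹ * x * q ∈ (P.H w).map (QuotientGroup.mk' L)) →
      q ∈ (P.H w).map (QuotientGroup.mk' L))
    (w : 𝔾.Vertex) : ∃ k ∈ L, P.IsVConj Φ σ e w k := by
  obtain ⟨k, hk⟩ := hP.exists_isVConj e w
  have hσw : (σ e).hom.vertexMap w = w := by rw [hσ]; rfl
  have hk' : ∀ x : Γ, x ∈ P.H w ↔ k⁻¹ * Φ e x * k ∈ P.H w := fun x => by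
    have := hk x; rwa [hσw] at this
  set π := QuotientGroup.mk' L with hπ
  -- `π k` normalises the image of `H_w`
  have hnorm : ∀ x : Γ ⧸ L, x ∈ (P.H w).map π ↔ (π k)⁻¹ * x * π k ∈ (P.H w).map π := by
    intro x
    obtain ⟨x, rfl⟩ := QuotientGroup.mk'_surjective L x
    constructor
    · rintro ⟨h, hh, hhx⟩
      refine ⟨k⁻¹ * Φ e h * k, (hk' h).mp hh, ?_⟩
      rw [map_mul, map_mul, mk_map_eq_of_congruent L hcong h, ← hhx, map_inv]
    · rintro ⟨h', hh', hh'x⟩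
      -- `y := Φ_e⁻¹ (k h' k⁻¹)` lies in `H_w` and reduces to `x`
      refine ⟨(Φ e)⁻¹ (k * h' * k⁻¹), (hk' _).mpr (by simpa [mul_assoc] using hh'), ?_⟩
      have h1 : π (Φ e ((Φ e)⁻¹ (k * h' * k⁻¹))) = π ((Φ e)⁻¹ (k * h' * k⁻¹)) :=
        mk_map_eq_of_congruent L hcong _
      rw [MulAut.apply_inv_self] at h1
      rw [← h1, map_mul, map_mul, hh'x, map_inv]
      group
  obtain ⟨h, hh, hhk⟩ := hself w (π k) hnorm
  -- `k = h l` with `l ∈ L`; the conjugator `k h⁻¹ = h l h⁻¹ ∈ L` works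
  have hl : h⁻¹ * k ∈ L := by
    rw [hπ, QuotientGroup.mk'_apply, QuotientGroup.mk'_apply, QuotientGroup.eq] at hhk
    exact hhk
  refine ⟨k * h⁻¹, ?_, fun x => ?_⟩
  · have : k * h⁻¹ = h * (h⁻¹ * k) * h⁻¹ := by group
    rw [this]
    exact Subgroup.Normal.conj_mem inferInstance _ hl h
  · rw [hσw, hk' x]
    have : (k * h⁻¹)⁻¹ * Φ e x * (k * h⁻¹) = h * (k⁻¹ * Φ e x * k) * h⁻¹ := by group
    rw [this]
    constructor
    · intro hx; exact (P.H w).mul_mem ((P.H w).mul_mem hh hx) ((P.H w).inv_mem hh)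
    · intro hx
      have := (P.H w).mul_mem ((P.H w).mul_mem ((P.H w).inv_mem hh) hx) hh
      simpa [mul_assoc] using this

/-- **On a SIMPLE level** (an edge of the coset semi-graph is determined by the vertices its branches
abut to — e.g. a TREE level, where there are no parallel edges) **with self-normalising vertex images,
an element with `σ_e = 1` and `Φ_e ≡ id (mod L)` acts trivially**: the vertex conjugators lie in `L`
(`exists_isVConj_mem_of_congruent`), so every vertex is fixed; every edge then keeps its end vertices,
hence is fixed by simplicity; branches follow. [cite: MochizukiSemiAnbd2006, Prop 5.2 (i), p. 63] -/
theorem arithAct_eq_one_of_congruent_of_simple [L.Normal] {e : E} (hσ : σ e = 1)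
    (hcong : ∀ y : Γ, Φ e y * y⁻¹ ∈ L)
    (hself : ∀ (w : 𝔾.Vertex) (q : Γ ⧸ L),
      (∀ x : Γ ⧸ L, x ∈ (P.H w).map (QuotientGroup.mk' L) ↔
        q⁻¹ * x * q ∈ (P.H w).map (QuotientGroup.mk' L)) →
      q ∈ (P.H w).map (QuotientGroup.mk' L))
    (hsimple : ∀ (ε : 𝔾.Edge) (y₁ y₂ : Γ),
      (∀ (b : 𝔾.Branch) (w : 𝔾.Vertex), 𝔾.edgeOf b = ε → 𝔾.abuts b = some w →
        P.vMk L w (P.s b * y₁) = P.vMk L w (P.s b * y₂)) → P.eMk L ε y₁ = P.eMk L ε y₂) :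
    P.arithAct hP L hL e = 1 := by
  -- vertices are fixed
  have hvert : ∀ (w : 𝔾.Vertex) (y : Γ),
      (P.arithHom hP L hL e).vertexMap (P.vMk L w y) = P.vMk L w y := by
    intro w y
    obtain ⟨k, hk, hkV⟩ := P.exists_isVConj_mem_of_congruent hP L hσ hcong hself w
    rw [P.arithHom_vertexMap_vMk hP L hL hkV]
    exact P.vMk_eq L (by rw [hσ]; rfl) (mk_inv_mul_eq_of_mem L (P.H w) hk (hcong y))
  -- edges are fixed, by simplicity
  have hedge : ∀ (ε : 𝔾.Edge) (y : Γ),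
      P.eMk L ε ((P.eConj hP e ε)⁻¹ * Φ e y) = P.eMk L ε y := by
    intro ε y
    apply hsimple
    intro b w hb hw
    subst hb
    have habut := (P.arithHom hP L hL e).abuts_branchMap (P.bMk L b y) (P.vMk L w (P.s b * y))
      (P.cosetGraph_abuts_bMk L b w hw y)
    rw [hvert, P.arithHom_branchMap_bMk hP L hL (P.isEConj_eConj hP e (𝔾.edgeOf b)),
      show (σ e).hom.branchMap b = b by rw [hσ]; rfl, P.cosetGraph_abuts_bMk L b w hw] at habut
    exact Option.some.inj habut
  ext : 1
  refine P.hom_ext_mk L _ _ (fun w y => hvert w y) (fun ε y => ?_) (fun b y => ?_)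
  · change (P.arithHom hP L hL e).edgeMap _ = P.eMk L ε y
    rw [P.arithHom_edgeMap_eMk hP L hL (P.isEConj_eConj hP e ε)]
    rw [show (σ e).hom.edgeMap ε = ε by rw [hσ]; rfl]
    exact hedge ε y
  · change (P.arithHom hP L hL e).branchMap _ = P.bMk L b y
    rw [P.arithHom_branchMap_bMk hP L hL (P.isEConj_eConj hP e (𝔾.edgeOf b))]
    have hy := hedge (𝔾.edgeOf b) y
    exact P.branch_eq L (by rw [hσ]; rfl) (by rw [hσ]; rfl) (eq_of_heq (Sigma.mk.inj hy).2) _ _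

/-- Hence on such levels `e ∈ levelKer L` as soon as `σ_e = 1` and `Φ_e ≡ id (mod L)`, and the binder
`hK1′` reduces to pure CONGRUENCE-CONTINUITY of the outer action at the level `L` (no conjugator
clause). [cite: MochizukiSemiAnbd2006, Prop 5.2 (iv), p. 64] -/
theorem isOpen_map_levelKer_of_congruent_lifts_of_simple [L.Normal] {A : Type w} [Group A]
    [TopologicalSpace A] [ContinuousMul A] (aug : E →* A)
    (hself : ∀ (w : 𝔾.Vertex) (q : Γ ⧸ L),
      (∀ x : Γ ⧸ L, x ∈ (P.H w).map (QuotientGroup.mk' L) ↔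
        q⁻¹ * x * q ∈ (P.H w).map (QuotientGroup.mk' L)) →
      q ∈ (P.H w).map (QuotientGroup.mk' L))
    (hsimple : ∀ (ε : 𝔾.Edge) (y₁ y₂ : Γ),
      (∀ (b : 𝔾.Branch) (w : 𝔾.Vertex), 𝔾.edgeOf b = ε → 𝔾.abuts b = some w →
        P.vMk L w (P.s b * y₁) = P.vMk L w (P.s b * y₂)) → P.eMk L ε y₁ = P.eMk L ε y₂)
    {U : Set A} (hU : U ∈ 𝓝 (1 : A))
    (hlift : ∀ a ∈ U, ∃ e : E, aug e = a ∧ σ e = 1 ∧ ∀ y : Γ, Φ e y * y⁻¹ ∈ L) :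
    IsOpen (((P.levelKer hP L hL).map aug : Subgroup A) : Set A) := by
  apply Subgroup.isOpen_of_mem_nhds _ (g := 1)
  apply Filter.mem_of_superset hU
  intro a ha
  obtain ⟨e, rfl, hσ, hcong⟩ := hlift a ha
  have hmem : e ∈ P.levelKer hP L hL := by
    rw [P.mem_levelKer_iff hP L hL]
    exact ⟨P.arithAct_eq_one_of_congruent_of_simple hP L hL hσ hcong hself hsimple, hσ, hcong⟩
  exact ⟨e, hmem, rfl⟩

end SubgroupPresentation

end SemiGraph

/-! ### Openness of the images only matters at deep levels -/

namespace TemperedExtension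

variable {E : Type v} [Group E] {A : Type w} [Group A] [TopologicalSpace A] [ContinuousMul A]
  (aug : E →* A)

/-- For an antitone family of subgroups, an open image at a deeper level gives an open image at every
shallower level. [cite: MochizukiSemiAnbd2006, Prop 5.2 (iv), p. 64] -/
theorem isOpen_map_of_antitone (K : ℕ → Subgroup E) (hanti : Antitone K) {n m : ℕ} (hnm : n ≤ m)
    (h : IsOpen (((K m).map aug : Subgroup A) : Set A)) :
    IsOpen (((K n).map aug : Subgroup A) : Set A) :=
  Subgroup.isOpen_mono (Subgroup.map_mono (hanti hnm)) h

/-- Hence the binder `hK1′ : ∀ n, IsOpen (aug (K n))` of `exists_isTempered_topology_of_kernelSeq`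
follows from openness at a COFINAL set of levels. [cite: MochizukiSemiAnbd2006, Prop 5.2 (iv), p. 64] -/
theorem isOpen_map_of_frequently (K : ℕ → Subgroup E) (hanti : Antitone K)
    (h : ∀ n, ∃ m, n ≤ m ∧ IsOpen (((K m).map aug : Subgroup A) : Set A)) (n : ℕ) :
    IsOpen (((K n).map aug : Subgroup A) : Set A) := by
  obtain ⟨m, hnm, hm⟩ := h n
  exact isOpen_map_of_antitone aug K hanti hnm hm

end TemperedExtension

end Literature.AnabelianGeometry.SemiGraphs
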